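import Summits.Ventures.PercRepro2.CaseOneGadgetUWOBPartsI

/-!
# The gadget `u ~ {w, o, b}`, `w ~ {u, a₁, a₂}`: the parts of the mass `YU`
(blind cell PercRepro2, p1 g21; S5 §2.1 (K9) (l) — the Q-threshold forms of the uwob class)

The mass `Y_U = P(Q, o ∈ U)` of the two Q-threshold forms `iiqG5`, `iqG5` is multilinear in `e₀, e₁, e₂`; its parts `pgYU abc` (`sgYU_parts`). The parts of the other masses are in `CaseOneGadgetUWOBParts.lean` / `CaseOneGadgetUWOBPartsI.lean`. -/

namespace Summit.Ventures.PercRepro2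

namespace CaseOne

section PartsG5Q
variable {R : Type*} [CommRing R]

/-- The `e₀^0 e₁^0 e₂^0` part of the mass `YU`. -/
def pgYU000 (e₃ e₄ : R) (m : SCells R) : R :=
  (-1 : R) * e₃ * e₄ * m.c4 + (-1 : R) * e₃ * e₄ * m.c5 + (-1 : R) * e₃ * e₄ * m.c3 + (-1 : R) * e₃ * e₄ * m.c7 + (-1 : R) * e₃ * e₄ * m.c8 + (-1 : R) * e₃ * e₄ * m.c6 + (1 : R) * m.c4 + (1 : R) * m.c5 + (1 : R) * m.c3 + (1 : R) * m.c7 + (1 : R) * m.c8 + (1 : R) * m.c6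

/-- The `e₀^1 e₁^0 e₂^1` part of the mass `YU`. -/
def pgYU101 (e₃ e₄ : R) (m : SCells R) : R :=
  (1 : R) * e₃ * e₄ * m.c4 + (1 : R) * e₃ * e₄ * m.c5 + (1 : R) * e₃ * e₄ * m.c7 + (1 : R) * e₃ * e₄ * m.c8 + (-2 : R) * e₃ * e₄ * m.c10 + (-1 : R) * e₃ * m.c5 + (-1 : R) * e₃ * m.c8 + (1 : R) * e₃ * m.c10 + (-1 : R) * e₄ * m.c4 + (-1 : R) * e₄ * m.c7 + (1 : R) * e₄ * m.c10

/-- The `e₀^1 e₁^1 e₂^0` part of the mass `YU`. -/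
def pgYU110 (e₃ e₄ : R) (m : SCells R) : R :=
  (1 : R) * e₃ * e₄ * m.c4 + (1 : R) * e₃ * e₄ * m.c5 + (1 : R) * e₃ * e₄ * m.c3 + (1 : R) * e₃ * e₄ * m.c7 + (1 : R) * e₃ * e₄ * m.c8 + (1 : R) * e₃ * e₄ * m.c6 + (-2 : R) * e₃ * e₄ * m.c1 + (-2 : R) * e₃ * e₄ * m.c2 + (-2 : R) * e₃ * e₄ * m.c10 + (-2 : R) * e₃ * e₄ * m.c9 + (-1 : R) * e₃ * m.c7 + (-1 : R) * e₃ * m.c8 + (-1 : R) * e₃ * m.c6 + (1 : R) * e₃ * m.c1 + (1 : R) * e₃ * m.c2 + (1 : R) * e₃ * m.c10 + (1 : R) * e₃ * m.c9 + (-1 : R) * e₄ * m.c4 + (-1 : R) * e₄ * m.c5 + (-1 : R) * e₄ * m.c3 + (1 : R) * e₄ * m.c1 + (1 : R) * e₄ * m.c2 + (1 : R) * e₄ * m.c10 + (1 : R) * e₄ * m.c9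

/-- The `e₀^1 e₁^1 e₂^1` part of the mass `YU`. -/
def pgYU111 (e₃ e₄ : R) (m : SCells R) : R :=
  (-1 : R) * e₃ * e₄ * m.c4 + (-2 : R) * e₃ * e₄ * m.c5 + (-2 : R) * e₃ * e₄ * m.c7 + (-1 : R) * e₃ * e₄ * m.c8 + (3 : R) * e₃ * e₄ * m.c1 + (3 : R) * e₃ * e₄ * m.c2 + (2 : R) * e₃ * e₄ * m.c10 + (1 : R) * e₃ * m.c5 + (1 : R) * e₃ * m.c7 + (1 : R) * e₃ * m.c8 + (-1 : R) * e₃ * m.c1 + (-2 : R) * e₃ * m.c2 + (-1 : R) * e₃ * m.c10 + (1 : R) * e₄ * m.c4 + (1 : R) * e₄ * m.c5 + (1 : R) * e₄ * m.c7 + (-2 : R) * e₄ * m.c1 + (-1 : R) * e₄ * m.c2 + (-1 : R) * e₄ * m.c10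

/-- The `e₀^0 e₁^1 e₂^1` part of the mass `YU`. -/
def pgYU011 (e₃ e₄ : R) (m : SCells R) : R :=
  (1 : R) * e₃ * e₄ * m.c5 + (1 : R) * e₃ * e₄ * m.c7 + (-1 : R) * e₃ * e₄ * m.c1 + (-1 : R) * e₃ * e₄ * m.c2 + (-1 : R) * m.c5 + (-1 : R) * m.c7 + (1 : R) * m.c1 + (1 : R) * m.c2

/-- The mass `YU` is multilinear in `e₀, e₁, e₂`: its parts. -/
lemma sgYU_parts (e₀ e₁ e₂ e₃ e₄ : R) (m : SCells R) :
    sgYU e₀ e₁ e₂ e₃ e₄ m = pgYU000 e₃ e₄ m + e₀ * e₂ * pgYU101 e₃ e₄ m + e₀ * e₁ * pgYU110 e₃ e₄ m + e₀ * e₁ * e₂ * pgYU111 e₃ e₄ m + e₁ * e₂ * pgYU011 e₃ e₄ m := by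
  unfold sgYU pgYU000 pgYU101 pgYU110 pgYU111 pgYU011
  ring

end PartsG5Q

end CaseOne

end Summit.Ventures.PercRepro2
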